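import Summits.ABC.StewartYu.PadicG3TwoFirstExp
import Summits.ABC.StewartYu.PadicG3TwoHeadline
import Summits.ABC.StewartYu.PadicG3TwoDatumPackage
import Summits.ABC.StewartYu.PadicG3TwoParTwo
import Summits.ABC.StewartYu.PadicG3TwoNegBound
import HarnessLib

/-!
# Cell abc-stewartyu, Gen-3 frame at `p = 2` (crux `Y07Two`, stmt-ABC-19659): THE CLOSER — the registered stub
# `stub_frameTwoLast` of the crux skeleton as a tree theorem

`Summits/ABC/StewartYu/PadicG3TwoClose.lean` — cell `abc-stewartyu` (HOME `run/shared/lean/pub/abc-stewartyu/`),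
route `PadicPrimesKummerThird`, seat p3 (g6, F-two lead).  Theorems only.

**`frameTwoLast_all`** : `∃ C c₁, 1 ≤ c₁ ∧ (∀ m, 0 ≤ C m ∧ C m ≤ c₁^m) ∧ 4 ≤ C 1 ∧ (Nesterenko2003_prop51 →
∀ d ≥ 1, GenThreeFramePivotTwo.FrameTwoLast C d)` with `C m := 2^{110 m}`, `c₁ := 2^{110}` — literally the signature
of the registered stub `stub_frameTwoLast` of crux stmt-ABC-19659.  Per pivot-last datum under the negated bound:
the `2`-adic set-up `S := TwoSetup.ofData`, the `p = 2` ledger `P := ParTwo.parTwo` (`N_q = 2^{m+2}`,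
`Amax = min Vmax (2ⁿ∏V)`), the schedule of record `schedTwoS S P` with its numerics (p5:
`frameNumericsTwoRA_schedTwoS` inside `datum_package_two` — depth fit, (L1), END block), the budget lines (L2₀)/(L2)
(`PadicG3TwoBudgetK`) and (L3ᴿ) (`PadicG3TwoBudgetT`) for the gain branches, the `‖Λ₀‖`-branches from ONE
smallness exponent (`PadicG3TwoFirstExp`) supplied by the negated bound through the HEADLINE
(`PadicG3TwoHeadline.headline_two`: exponent `≤ 2^{110 n}·∏V·(W + log 2Vmax)`) and `PadicG3TwoNegBound`, and the
record `RecordTwo` by name (lp-1 `RecordNumericC` via `ParTwo.recordTwo_parTwo`).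

WHAT THIS IS NOT: the crux file itself (`Summits/ABC/ABC/Theorems/PadicPrimesKummerThirdY07Two.lean` applies this
theorem verbatim); no new mathematics beyond glue.

References: K. Yu, Acta Math. 211 (2013), §§3–6; Yu. V. Nesterenko, LNM 1819 (2003), §§3–5; K. Yu, Forum Math.
19 (2007), Main Theorem (`K = ℚ`, `℘ = 2`).
-/

noncomputable section

open Finset
open Literature.NumberTheory.Transcendental
open Literature.NumberTheory.Transcendental.CW77 (heightProd)
open Literature.NumberTheory.Transcendental.CW77.Setup (Tau tauNorm)
open Literature.NumberTheory.Transcendental.PadicCW77 (condExp)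

namespace Summit.ABC.StewartYu

namespace TwoSetup

open Summit.ABC.StewartYu.PadicG3Par Summit.ABC.StewartYu.ParTwo

/-! ### The `p = 2` ledger of a datum: identities used by the budget lines -/

section Datum

variable {d : ℕ} (V : Fin (d + 1) → ℝ) (Vmax W : ℝ)
  (hV1 : ∀ j, 1 ≤ V j) (hVmax : ∀ j, V j ≤ Vmax) (hW1 : 1 ≤ W)

/-- `N_q = 2^{m+2}` for the datum's ledger. [folklore] -/
theorem parTwo_Nq_eq : (parTwo V Vmax W hV1 hVmax hW1).Nq = 2 ^ ((parTwo V Vmax W hV1 hVmax hW1).m + 2) := by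
  rw [parTwo_Nq, parTwo_m]

/-- `G = (m+2)·log 2` for the datum's ledger. [folklore] -/
theorem parTwo_G_eq :
    (parTwo V Vmax W hV1 hVmax hW1).G = ((parTwo V Vmax W hV1 hVmax hW1).m + 2) * Real.log 2 := by
  rw [parTwo_G, parTwo_m]

/-- **`2G ≤ yload`** for the datum's ledger (`Ŝ = n + 26 + m ≥ m + 2`). [folklore] -/
theorem parTwo_yload : 2 * (parTwo V Vmax W hV1 hVmax hW1).G ≤ (parTwo V Vmax W hV1 hVmax hW1).yload := by
  set P := parTwo V Vmax W hV1 hVmax hW1 with hP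
  have hG : P.G = (P.m + 2) * Real.log 2 := parTwo_G_eq V Vmax W hV1 hVmax hW1
  have hS : P.Sdepth = d + 1 + 24 + (mTwo (d + 1) + 2) := parTwo_Sdepth V Vmax W hV1 hVmax hW1
  have hm : P.m = mTwo (d + 1) := parTwo_m V Vmax W hV1 hVmax hW1
  unfold PadicG3Par.yload
  have hlog2 : 0 < Real.log 2 := Real.log_pos (by norm_num)
  have hp : (P.p : ℝ) = 2 := by rw [hP, parTwo_p]; norm_num
  have hlogp : 0 ≤ Real.log P.p := by rw [hp]; exact hlog2.le
  have hd0 : (0 : ℝ) ≤ d := by positivity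
  have hlogn : 0 ≤ Real.log ((d : ℝ) + 1 + 1) := Real.log_nonneg (by linarith)
  have hSd : ((P.m : ℝ) + 2) ≤ (P.Sdepth : ℝ) + (d + 1 : ℕ) + 1 := by
    rw [hS, hm]; push_cast; linarith
  have h1 : (P.m + 2 : ℝ) * Real.log 2 ≤ ((P.Sdepth : ℝ) + (d + 1 : ℕ) + 1) * Real.log 2 :=
    mul_le_mul_of_nonneg_right hSd hlog2.le
  rw [hG]
  push_cast at h1 ⊢
  linarith

end Datum

/-! ### The closer -/

/-- `|b| ≤ e^W` from `log max(3,|b|) ≤ W`. [folklore] -/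
theorem abs_le_exp_of_log_max_le {b : ℤ} {W : ℝ} (h : Real.log (max 3 (|b| : ℝ)) ≤ W) :
    |(b : ℝ)| ≤ Real.exp W := by
  have hpos : (0 : ℝ) < max 3 (|b| : ℝ) := lt_of_lt_of_le (by norm_num) (le_max_left _ _)
  have h1 : max 3 (|b| : ℝ) ≤ Real.exp W := (Real.log_le_iff_le_exp hpos).mp h
  have h2 : (|b| : ℝ) ≤ max 3 (|b| : ℝ) := le_max_right _ _
  have e : ((|b| : ℤ) : ℝ) = |(b : ℝ)| := Int.cast_abs
  linarith [e ▸ h2]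

/-- `e^W ≤ 2^{⌈2W⌉₊}`. [folklore] -/
theorem exp_le_two_pow_ceil (W : ℝ) : Real.exp W ≤ (2 : ℝ) ^ ⌈2 * W⌉₊ := by
  have hl := Real.log_two_gt_d9
  have h1 : W ≤ (⌈2 * W⌉₊ : ℝ) * Real.log 2 := by
    have hc : 2 * W ≤ (⌈2 * W⌉₊ : ℝ) := Nat.le_ceil _
    nlinarith
  calc Real.exp W ≤ Real.exp ((⌈2 * W⌉₊ : ℝ) * Real.log 2) := Real.exp_le_exp.mpr h1
    _ = (2 : ℝ) ^ ⌈2 * W⌉₊ := by rw [Real.exp_nat_mul, Real.exp_log (by norm_num)]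

/-- **THE REGISTERED STUB `stub_frameTwoLast` OF CRUX stmt-ABC-19659 AS A TREE THEOREM** (`C m = 2^{110 m}`).
[cite: Yu2007, Main Thm (K = ℚ, ℘ = 2); shape only] -/
theorem frameTwoLast_all :
    ∃ (C : ℕ → ℝ) (c₁ : ℝ), 1 ≤ c₁ ∧ (∀ m, 0 ≤ C m ∧ C m ≤ c₁ ^ m) ∧ 4 ≤ C 1 ∧
      (Nesterenko2003_prop51 → ∀ d, 1 ≤ d → GenThreeFramePivotTwo.FrameTwoLast C d) := by
  refine stub_frameTwoLast_of_numericsRA (C := fun m => (2 : ℝ) ^ (110 * m)) (c₁ := (2 : ℝ) ^ 110)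
    (one_le_pow₀ (by norm_num)) (fun m => ⟨by positivity, by rw [← pow_mul]⟩) (by norm_num) ?_
  intro _hZ d hd α b V Vmax W hα hind hKZ hV hV1 hVmax hb hmin hW hW1 hneg
  -- the set-up and the ledger of the datum
  set S : TwoSetup := ofData d α b hα hb hmin with hSdef
  set P : PadicG3Par (d + 1) := parTwo V Vmax W hV1 hVmax hW1 with hPdef
  -- instantiation facts
  have hp : P.p = 2 := parTwo_p V Vmax W hV1 hVmax hW1
  have hK₀ : P.K₀ = 1 := parTwo_K₀ V Vmax W hV1 hVmax hW1
  have hθ : (1 / 2 : ℝ) ≤ P.θ₀ := parTwo_half_le_θ₀ V Vmax W hV1 hVmax hW1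
  have hNq : P.Nq = 2 ^ (P.m + 2) := parTwo_Nq_eq V Vmax W hV1 hVmax hW1
  have hNqK : P.Nq ≤ 2 ^ (d + 1) * P.K := parTwo_Nq_le V Vmax W hV1 hVmax hW1 hd
  have hAmaxΩ : P.Amax ≤ 2 ^ (d + 1) * P.Ω := parTwo_Amax_le V Vmax W hV1 hVmax hW1
  have hAmaxV : P.Amax ≤ Vmax := parTwo_Amax_le_Vmax V Vmax W hV1 hVmax hW1
  have hA1 : ∀ j, 1 ≤ P.A j := hV1
  have hG : P.G = (P.m + 2) * Real.log 2 := parTwo_G_eq V Vmax W hV1 hVmax hW1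
  have hy : 2 * P.G ≤ P.yload := parTwo_yload V Vmax W hV1 hVmax hW1
  -- datum links for the set-up
  have hαl : ∀ j, Height.logHeight₁ (S.α j) ≤ P.A (Fin.castSucc j) := fun j => hV (Fin.castSucc j)
  have hθl : Height.logHeight₁ S.θ ≤ P.A (Fin.last d) := hV (Fin.last d)
  have hbl : ∀ j, |(S.b j : ℝ)| ≤ Real.exp P.W := fun j => abs_le_exp_of_log_max_le (hW (Fin.castSucc j))
  have hbθl : |(S.bθ : ℝ)| ≤ Real.exp P.W := abs_le_exp_of_log_max_le (hW (Fin.last d))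
  have hdepth : 8 * 3 ^ S.Istar3 P ≤ 4 * P.L := S.hdepth_two P hNq
  -- the smallness from the negated bound through the headline
  set U2 : ℕ := (P.m + 6) * ((d + 3) * (3 ^ (d + 5) * (P.X * P.L))) with hU2
  set Utot : ℕ := (P.m + 6) * ((d + 1 + 2) * (3 ^ (d + 1 + 4) * (P.X * P.L))) + P.m + 3 + ⌈2 * P.W⌉₊ with hUtot
  have hUU : Utot = U2 + P.m + 3 + ⌈2 * P.W⌉₊ := by rw [hUtot, hU2]
  have hhead := P.headline_two hp hK₀ hθ hNqK hAmaxΩ hA1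
  have hΩ : P.Ω = ∏ j, V j := parTwo_Ω V Vmax W hV1 hVmax hW1
  have hVmax1 : 1 ≤ Vmax := (hV1 0).trans (hVmax 0)
  have hlogV : Real.log (2 * P.Amax) ≤ Real.log (2 * Vmax) :=
    Real.log_le_log (by linarith [P.hAmax1]) (by linarith)
  have hprod : 0 ≤ ∏ j, V j := Finset.prod_nonneg fun j _ => by linarith [hV1 j]
  have hWP : P.W = W := rfl
  have hUT : (Utot : ℝ) ≤ (2 : ℝ) ^ (110 * (d + 1)) * (∏ j, V j) * (W + Real.log (2 * Vmax)) := by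
    refine hhead.trans ?_
    have h2 : P.Ω * (P.W + Real.log (2 * P.Amax)) ≤ (∏ j, V j) * (W + Real.log (2 * Vmax)) := by
      rw [hΩ, hWP]
      exact mul_le_mul_of_nonneg_left (by linarith) hprod
    have h3 : (0 : ℝ) ≤ (2 : ℝ) ^ (110 * (d + 1)) := by positivity
    have h4 := mul_le_mul_of_nonneg_left h2 h3
    have e1 : (2 : ℝ) ^ (110 * (d + 1)) * (P.Ω * (P.W + Real.log (2 * P.Amax))) =
        (2 : ℝ) ^ (110 * (d + 1)) * P.Ω * (P.W + Real.log (2 * P.Amax)) := by ring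
    have e2 : (2 : ℝ) ^ (110 * (d + 1)) * ((∏ j, V j) * (W + Real.log (2 * Vmax))) =
        (2 : ℝ) ^ (110 * (d + 1)) * (∏ j, V j) * (W + Real.log (2 * Vmax)) := by ring
    linarith
  have hb0 : b ≠ 0 := fun h0 => hb (by rw [h0]; rfl)
  have hΛ₀ := norm_Λ₀_ofData_le_of_not_le α b hα hb hmin hind hb0 hneg hUT
  -- `‖Λ₀‖ ≤ 2^{−(U2 + m + 3)}`
  have hΛall : ‖S.Λ₀‖ ≤ ((2 : ℝ) ^ (U2 + (P.m + 3)))⁻¹ := by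
    have hbW : |(b (Fin.last d) : ℝ)| ≤ (2 : ℝ) ^ ⌈2 * P.W⌉₊ :=
      (abs_le_exp_of_log_max_le (hW (Fin.last d))).trans (exp_le_two_pow_ceil _)
    have h2 : (((2 : ℕ) : ℝ)) ^ (-(Utot : ℤ)) = ((2 : ℝ) ^ Utot)⁻¹ := by
      rw [zpow_neg, zpow_natCast]; norm_num
    rw [h2] at hΛ₀
    have hsplit : (2 : ℝ) ^ Utot = (2 : ℝ) ^ (U2 + (P.m + 3)) * (2 : ℝ) ^ ⌈2 * P.W⌉₊ := by
      rw [hUU, ← pow_add]; ring_nf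
    have hpos1 : (0 : ℝ) < (2 : ℝ) ^ (U2 + (P.m + 3)) := by positivity
    have hpos2 : (0 : ℝ) < (2 : ℝ) ^ ⌈2 * P.W⌉₊ := by positivity
    calc ‖S.Λ₀‖ ≤ |(b (Fin.last d) : ℝ)| * ((2 : ℝ) ^ Utot)⁻¹ := hΛ₀
      _ ≤ (2 : ℝ) ^ ⌈2 * P.W⌉₊ * ((2 : ℝ) ^ Utot)⁻¹ := mul_le_mul_of_nonneg_right hbW (by positivity)
      _ = ((2 : ℝ) ^ (U2 + (P.m + 3)))⁻¹ := by rw [hsplit, mul_inv, ← mul_assoc, mul_comm, ← mul_assoc,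
          inv_mul_cancel₀ hpos2.ne', one_mul]
  have hΛm : ‖S.Λ₀‖ ≤ ((2 : ℝ) ^ (P.m + 3))⁻¹ := le_inv_two_pow_of_le (by omega) hΛall
  have hΛU : ‖S.Λ₀‖ ≤ ((2 : ℝ) ^ U2)⁻¹ := le_inv_two_pow_of_le (by omega) hΛall
  -- the budget lines: gain branches + first branches
  have hBw0 : ∀ I, 0 ≤ (S.schedTwoS P).Bw I := fun I => by rw [schedTwoS_Bw]; exact (S.Bw3_pos P).le
  have hg₀ := S.hL2zero_gain_schedTwoS P hG hy hA1 hαl hθl hbl hbθl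
  have hg := S.hL2_gain_schedTwoS P hG hy hA1 hαl hθl hbl hbθl hdepth
  have hg3 := S.hL3_gain_schedTwoS P hG hy hA1 hαl hθl hbl hbθl hdepth
  refine S.datum_package_two P hNq ?_ ?_ ?_ hΛm
    (recordTwo_parTwo V Vmax W hV1 hVmax hW1 hd (fun r => by positivity) ?_)
  · -- (L2₀)
    intro k hk x₁ hx₁ τ hτ
    have hB := hg₀ k hk x₁ hx₁ τ hτ
    have hk' : k < d + 3 := by rw [schedTwoS_kst] at hk; exact hk
    have he := S.kExpA_schedTwoS_le P (k := k) hk'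
    refine max_lt (lt_of_le_of_lt (first_le_gain (hBw0 0) (le_inv_two_pow_of_le he hΛU)) hB) hB
  · -- (L2)
    intro I hI1 hI k hk x₁ hx₁ τ hτ
    have hB := hg I hI1 hI k hk x₁ hx₁ τ hτ
    have hk' : k < d + 3 := by rw [schedTwoS_kst] at hk; exact hk
    have he := S.kExp_schedTwoS_le P I (k := k) hk'
    exact kstep_hfinal_of_gain (S.schedTwoS P) (hBw0 I) (le_inv_two_pow_of_le he hΛU) hB
  · -- (L3ᴿ)
    intro I hI s hs h3 τ hτ
    have hB := hg3 I hI s hs h3 τ hτ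
    have he := S.tExp_schedTwoS_le P I
    exact third_hfinal_of_gain (S.schedTwoS P) (hBw0 I) (le_inv_two_pow_of_le he hΛU) hB
  · -- admissibility of `C m = 2^{110 m}`: `256^{n−r}·C r ≤ C n`
    intro r hr
    rw [show (256 : ℝ) = 2 ^ 8 by norm_num, ← pow_mul, ← pow_add]
    exact pow_le_pow_right₀ (by norm_num) (by omega)

end TwoSetup

end Summit.ABC.StewartYu

end
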